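import Summits.QuantumFields.YangMills.Theses.SmallFieldWidening
import Summits.QuantumFields.YangMills.Theorems.SmallFieldWideningWideningOfTiltAndMass
import Literature.MathematicalPhysics.QuantumFieldTheory.Balaban1983to89.T3InteriorExcision
import HarnessLib

/-!
# Route `SmallFieldWidening` — crux r3 `LargeFieldMassRefinementTail` (stmt-QuantumFields-22884) IS UPWARD-CLOSED IN THE BAŁABAN PROFILE
# (support file, leaf; lead `ym-line-sfw-p2` gen 3, line `birth`)

WHY.  r3 is filed with an EXISTENTIAL profile («for every `L` there ARE `b₀ > 0`, `p₀ > 2`, `γ₁ > 0` …»), while the partner crux r2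
`AllHeightsSmallTilt` is filed for EVERY profile; the route's CLOSED deciding theorem `SmallFieldWidening.closes` feeds r3's profile into r2.
The critic graded r2 a VARIANT of route `UnitScaleTilt`'s K1′, whose packages are all stated «for every profile BEYOND THRESHOLDS
`(b₁, p₁)`» ([King1986] (3.12): the small-field comparison needs the thresholds large).  If r2 is ever re-stated in that thresholded form,
the assembly still closes PROVIDED r3's profile can be pushed beyond arbitrary thresholds.  It can, for free: Bałaban's threshold
`θ(i) = g_i·b₀(1 + log g_i⁻¹)^{p₀}` ([Balaban1985UV3] (7) p.257) is MONOTONE in `(b₀, p₀)` on couplings `g_i ≤ 1`, a larger threshold only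
ENLARGES the all-heights small-field event `histGood`, so the complement masses r3 bounds only DECREASE; and r3 is trivially downward-closed
in `γ₁` (fewer pairs `(n, K)` qualify), so `γ₁ ≤ 1` may be assumed, which puts every constrained coupling in `(0, 1]`.

CONTENT (all sorry-free, pure bookkeeping over tree definitions):
* `pFun_mono_profile`, `θBal_mono_profile` — `p(g)` and `θBal` are monotone in the profile on `g ∈ [0, 1]` / `0 ≤ γ ≤ 1`;
* `refinedMass_mono_profile` — the r3 body for one family/coupling passes from `(b₀, p₀, γ₁)` to any `(b₀', p₀', γ₁')` with `b₀ ≤ b₀'`,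
  `p₀ ≤ p₀'`, `γ₁' ≤ min γ₁ 1`, with the SAME `δ`;
* `largeFieldMassRefinementTail_beyond` / `largeFieldMassRefinementTail_iff_beyond` — **r3 ⇔ r3 with its profile beyond arbitrary thresholds
  `(b₁, p₁)` and `γ₁ ≤ 1`**;
* `ym3TorusSU2_of_thresholdedTilt` — the rung-R3 leaf from r3 and a THRESHOLDED all-heights tilt (r2 in `UnitScaleTilt`'s quantifier shape),
  through the landed widening `smallFieldWidening_wideningOfTiltAndMass_proof` — the assembly is robust to that restatement of r2.

WHAT THIS IS NOT: no estimate; r3 and r2 stay OPEN (r3's one registered stub `stub_avgTailPkg` is the K2-L lane's (α)-record frontier);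
nothing here bears on d = 4 or the Yang–Mills mass gap (rung R3 record only).
-/

set_option autoImplicit false

noncomputable section

open MeasureTheory Filter Topology
open Literature.MathematicalPhysics.QuantumFieldTheory.Balaban1983to89
open Literature.MathematicalPhysics.QuantumFieldTheory.Balaban1983to89.Missing
open Literature.MathematicalPhysics.QuantumFieldTheory.Balaban1983to89.T3ContinuumYM3Torus
open Literature.MathematicalPhysics.QuantumFieldTheory.Balaban1983to89.T3UnitScaleTilt
open Literature.MathematicalPhysics.QuantumFieldTheory.Balaban1983to89.T3UnitLawDensityEML
open Literature.MathematicalPhysics.QuantumFieldTheory.Balaban1983to89.T3InteriorExcision (histGood_mono_profile)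

namespace Summit.QuantumFields.YangMills.Theorems.LargeFieldMassRefinementTailProfileMono

/-! ## §1 Monotonicity of Bałaban's threshold in the profile -/

/-- **`p(g) = b₀(1 + log g⁻¹)^{p₀}` IS MONOTONE IN THE PROFILE** on couplings `0 ≤ g ≤ 1` (there `1 + log g⁻¹ ≥ 1`, so the real power is
monotone in the exponent and non-negative): `b₀ ≤ b₀'`, `p₀ ≤ p₀'`, `0 ≤ b₀` give `p_{b₀,p₀}(g) ≤ p_{b₀',p₀'}(g)`. [cite: Balaban1985UV3, (7) p.257] -/
theorem pFun_mono_profile {b₀ b₀' p₀ p₀' g : ℝ} (hg0 : 0 ≤ g) (hg1 : g ≤ 1) (hb : 0 ≤ b₀) (hbb : b₀ ≤ b₀')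
    (hpp : p₀ ≤ p₀') : B10.pFun b₀ p₀ g ≤ B10.pFun b₀' p₀' g := by
  unfold B10.pFun
  have hlog : 0 ≤ Real.log g⁻¹ := by
    rcases hg0.eq_or_lt with h | h
    · rw [← h, inv_zero, Real.log_zero]
    · exact Real.log_nonneg ((one_le_inv₀ h).mpr hg1)
  have hu : (1 : ℝ) ≤ 1 + Real.log g⁻¹ := by linarith
  have hu0 : (0 : ℝ) ≤ 1 + Real.log g⁻¹ := zero_le_one.trans hu
  calc b₀ * (1 + Real.log g⁻¹) ^ p₀ ≤ b₀' * (1 + Real.log g⁻¹) ^ p₀ :=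
        mul_le_mul_of_nonneg_right hbb (Real.rpow_nonneg hu0 _)
    _ ≤ b₀' * (1 + Real.log g⁻¹) ^ p₀' :=
        mul_le_mul_of_nonneg_left (Real.rpow_le_rpow_of_exponent_le hu hpp) (hb.trans hbb)

/-- **`θBal L γ b₀ p₀ i = g_i·p(g_i)`, `g_i = √(γL^{-i})`, IS MONOTONE IN THE PROFILE** for `γ ≤ 1` (then `g_i = √(γL^{-i}) ∈ [0, 1]` for
every `i` and every `L : ℕ`; `√` of a negative number is `0`). [cite: Balaban1985UV3, (3) p.256 and (7) p.257] -/
theorem θBal_mono_profile (L : ℕ) {γ b₀ b₀' p₀ p₀' : ℝ} (hγ1 : γ ≤ 1) (hb : 0 ≤ b₀) (hbb : b₀ ≤ b₀')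
    (hpp : p₀ ≤ p₀') (i : ℕ) : θBal L γ b₀ p₀ i ≤ θBal L γ b₀' p₀' i := by
  unfold θBal
  have hL0 : (0 : ℝ) ≤ ((L : ℝ)⁻¹) := inv_nonneg.mpr (Nat.cast_nonneg L)
  have hx1 : γ * ((L : ℝ)⁻¹) ^ i ≤ 1 :=
    calc γ * ((L : ℝ)⁻¹) ^ i ≤ 1 * 1 :=
          mul_le_mul hγ1 (pow_le_one₀ hL0 (Nat.cast_inv_le_one L)) (pow_nonneg hL0 i) zero_le_one
      _ = 1 := one_mul 1
  have hg0 : 0 ≤ Real.sqrt (γ * ((L : ℝ)⁻¹) ^ i) := Real.sqrt_nonneg _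
  have hg1 : Real.sqrt (γ * ((L : ℝ)⁻¹) ^ i) ≤ 1 := (Real.sqrt_le_sqrt hx1).trans_eq Real.sqrt_one
  exact mul_le_mul_of_nonneg_left (pFun_mono_profile hg0 hg1 hb hbb hpp) hg0

/-! ## §2 The r3 body is antitone in the profile (larger thresholds, smaller large-field masses) -/

/-- **THE r3 BODY PASSES TO ANY LARGER PROFILE AND ANY SMALLER `γ₁' ≤ min γ₁ 1`, WITH THE SAME `δ`**: for a family `F` and `γ > 0`, if the
Gibbs masses of the complements of the all-heights small-field events of the refined runs (`F.refine n` at `γL^{-n}`, all `K`, all `n` with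
`γL^{-n} ≤ γ₁`) are `≤ δ n` at profile `(b₀, p₀)`, then so they are at every `(b₀', p₀')` with `b₀ ≤ b₀'`, `p₀ ≤ p₀'` for the `n` with
`γL^{-n} ≤ γ₁'`: there every constrained coupling is `≤ 1`, the thresholds grow (`θBal_mono_profile`), `histGood` grows
(`T3InteriorExcision.histGood_mono_profile`), the complement shrinks, and `gibbsK` is a probability measure. [cite: Balaban1985UV3, (7) p.257] -/
theorem refinedMass_mono_profile (F : T3Family) {γ b₀ b₀' p₀ p₀' γ₁ γ₁' : ℝ} (hγ : 0 < γ) (hγγ : γ₁' ≤ γ₁)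
    (hγ₁'1 : γ₁' ≤ 1) (hb : 0 ≤ b₀) (hbb : b₀ ≤ b₀') (hpp : p₀ ≤ p₀') {δ : ℕ → ℝ}
    (h : ∀ n K : ℕ, γ * ((F.L : ℝ)⁻¹) ^ n ≤ γ₁ →
      (gibbsK (F.refine n) ℰp (γ * ((F.L : ℝ)⁻¹) ^ n) K).real
        (histGood (F.refine n) ℰp (θBal (F.refine n).L (γ * ((F.L : ℝ)⁻¹) ^ n) b₀ p₀) K 0)ᶜ ≤ δ n) :
    ∀ n K : ℕ, γ * ((F.L : ℝ)⁻¹) ^ n ≤ γ₁' →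
      (gibbsK (F.refine n) ℰp (γ * ((F.L : ℝ)⁻¹) ^ n) K).real
        (histGood (F.refine n) ℰp (θBal (F.refine n).L (γ * ((F.L : ℝ)⁻¹) ^ n) b₀' p₀') K 0)ᶜ ≤ δ n := by
  intro n K hle
  have hle₁ : γ * ((F.L : ℝ)⁻¹) ^ n ≤ γ₁ := hle.trans hγγ
  have hγn0 : 0 ≤ γ * ((F.L : ℝ)⁻¹) ^ n :=
    mul_nonneg hγ.le (pow_nonneg (inv_nonneg.mpr (Nat.cast_nonneg F.L)) n)
  have hγn1 : γ * ((F.L : ℝ)⁻¹) ^ n ≤ 1 := hle.trans hγ₁'1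
  have hsub : histGood (F.refine n) ℰp (θBal (F.refine n).L (γ * ((F.L : ℝ)⁻¹) ^ n) b₀ p₀) K 0 ⊆
      histGood (F.refine n) ℰp (θBal (F.refine n).L (γ * ((F.L : ℝ)⁻¹) ^ n) b₀' p₀') K 0 :=
    histGood_mono_profile (F.refine n) (fun i => θBal_mono_profile _ hγn1 hb hbb hpp i) K 0
  haveI := isProbabilityMeasure_gibbsK (F.refine n) ℰp hγn0 K
  exact (measureReal_mono (Set.compl_subset_compl.mpr hsub) (measure_ne_top _ _)).trans (h n K hle₁)

/-! ## §3 r3 ⇔ r3 beyond arbitrary thresholds -/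

/-- **r3 PUSHED BEYOND ARBITRARY THRESHOLDS**: from `LargeFieldMassRefinementTail`, for every block size `L` and every `(b₁, p₁)` there is
a profile `b₀ ≥ b₁`, `p₀ ≥ p₁` (still `b₀ > 0`, `p₀ > 2`) and `0 < γ₁ ≤ 1` with the SAME body (`max`/`min` of the filed witnesses;
`refinedMass_mono_profile`). [cite: Balaban1985UV3, (7) p.257] -/
theorem largeFieldMassRefinementTail_beyond
    (h : Summit.QuantumFields.YangMills.Theses.SmallFieldWidening.LargeFieldMassRefinementTail) (L : ℕ) (b₁ p₁ : ℝ) :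
    ∃ b₀ p₀ γ₁ : ℝ, b₁ ≤ b₀ ∧ p₁ ≤ p₀ ∧ 0 < b₀ ∧ 2 < p₀ ∧ 0 < γ₁ ∧ γ₁ ≤ 1 ∧
      ∀ (F : T3Family) (γ : ℝ), F.L = L → 0 < γ → ∃ δ : ℕ → ℝ, Tendsto δ atTop (𝓝 0) ∧
        ∀ n K : ℕ, γ * ((F.L : ℝ)⁻¹) ^ n ≤ γ₁ →
          (gibbsK (F.refine n) ℰp (γ * ((F.L : ℝ)⁻¹) ^ n) K).real
            (histGood (F.refine n) ℰp (θBal (F.refine n).L (γ * ((F.L : ℝ)⁻¹) ^ n) b₀ p₀) K 0)ᶜ ≤ δ n := by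
  obtain ⟨b₀, p₀, γ₁, hb, hp, hγ₁, hbody⟩ := h L
  refine ⟨max b₀ b₁, max p₀ p₁, min γ₁ 1, le_max_right _ _, le_max_right _ _, hb.trans_le (le_max_left _ _),
    hp.trans_le (le_max_left _ _), lt_min hγ₁ one_pos, min_le_right _ _, fun F γ hFL hγ => ?_⟩
  obtain ⟨δ, hδ, hmass⟩ := hbody F γ hFL hγ
  exact ⟨δ, hδ, refinedMass_mono_profile F hγ (min_le_left γ₁ 1) (min_le_right γ₁ 1) hb.le (le_max_left _ _)
    (le_max_left _ _) hmass⟩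

/-- **r3 ⇔ r3 WITH ITS PROFILE BEYOND ARBITRARY THRESHOLDS AND `γ₁ ≤ 1`** (kernel certificate of r3's quantifier strength: the filed
existential profile is as good as «beyond every `(b₁, p₁)`»; the converse instantiates the thresholds at `0`). [cite: Balaban1985UV3, (7) p.257] -/
theorem largeFieldMassRefinementTail_iff_beyond :
    Summit.QuantumFields.YangMills.Theses.SmallFieldWidening.LargeFieldMassRefinementTail ↔
      ∀ (L : ℕ) (b₁ p₁ : ℝ), ∃ b₀ p₀ γ₁ : ℝ, b₁ ≤ b₀ ∧ p₁ ≤ p₀ ∧ 0 < b₀ ∧ 2 < p₀ ∧ 0 < γ₁ ∧ γ₁ ≤ 1 ∧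
        ∀ (F : T3Family) (γ : ℝ), F.L = L → 0 < γ → ∃ δ : ℕ → ℝ, Tendsto δ atTop (𝓝 0) ∧
          ∀ n K : ℕ, γ * ((F.L : ℝ)⁻¹) ^ n ≤ γ₁ →
            (gibbsK (F.refine n) ℰp (γ * ((F.L : ℝ)⁻¹) ^ n) K).real
              (histGood (F.refine n) ℰp (θBal (F.refine n).L (γ * ((F.L : ℝ)⁻¹) ^ n) b₀ p₀) K 0)ᶜ ≤ δ n := by
  refine ⟨fun h L b₁ p₁ => largeFieldMassRefinementTail_beyond h L b₁ p₁, fun h L => ?_⟩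
  obtain ⟨b₀, p₀, γ₁, -, -, hb, hp, hγ₁, -, hbody⟩ := h L 0 0
  exact ⟨b₀, p₀, γ₁, hb, hp, hγ₁, hbody⟩

/-! ## §4 The assembly is robust to a thresholded restatement of r2 -/

/-- **THE RUNG-R3 LEAF FROM r3 AND A THRESHOLDED ALL-HEIGHTS TILT.**  If the all-heights unit tilt (crux r2's body `UnitTiltAt F γ b₀ p₀ 0`)
is available only for profiles BEYOND THRESHOLDS `(b₁(L), p₁(L))` — route `UnitScaleTilt`'s quantifier shape ([King1986] (3.12)) — then
together with r3 the leaf `YM3TorusSU2` still follows: r3's profile is pushed beyond the thresholds (`largeFieldMassRefinementTail_beyond`),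
and the rest is the route's deciding theorem verbatim through the LANDED widening `smallFieldWidening_wideningOfTiltAndMass_proof` and the
tree's `continuumYM3Torus_iff_hasContinuumLimit_SU`.  CONDITIONAL (both hypotheses open); no summit, no mass gap. [cite: King1986, Thm 3.4 (3.9)-(3.12) p.656] -/
theorem ym3TorusSU2_of_thresholdedTilt
    (hT : ∀ (L : ℕ), ∃ b₁ p₁ : ℝ, ∀ (b₀ p₀ : ℝ), b₁ ≤ b₀ → p₁ ≤ p₀ → 0 < b₀ → 2 < p₀ →
      ∃ γ₂ : ℝ, 0 < γ₂ ∧ ∀ (F : T3Family) (γ : ℝ), F.L = L → 0 < γ → γ ≤ γ₂ → UnitTiltAt F γ b₀ p₀ 0)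
    (hM : Summit.QuantumFields.YangMills.Theses.SmallFieldWidening.LargeFieldMassRefinementTail) :
    Literature.MathematicalPhysics.QuantumFieldTheory.Balaban1983to89.T3YM3TorusStatement.YM3TorusSU2 := by
  refine ⟨1, one_pos, fun F γ hγ _ => ?_⟩
  obtain ⟨b₁, p₁, hT'⟩ := hT F.L
  obtain ⟨b₀, p₀, γ₁, hb₁, hp₁, hb₀, hp₀, hγ₁, -, hM'⟩ := largeFieldMassRefinementTail_beyond hM F.L b₁ p₁
  obtain ⟨γ₂, hγ₂, hT''⟩ := hT' b₀ p₀ hb₁ hp₁ hb₀ hp₀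
  obtain ⟨δ, hδ, hmass⟩ := hM' F γ rfl hγ
  have hL : (1 : ℝ) < F.L := by exact_mod_cast F.hL.2
  have hL0 : (0 : ℝ) < F.L := zero_lt_one.trans hL
  have hq0 : 0 ≤ ((F.L : ℝ))⁻¹ := inv_nonneg.mpr hL0.le
  have hq1 : ((F.L : ℝ))⁻¹ ≤ 1 := inv_le_one_of_one_le₀ hL.le
  have hγs : 0 < min γ₁ γ₂ := lt_min hγ₁ hγ₂
  obtain ⟨n₀, hn₀⟩ := ((tendsto_pow_atTop_nhds_zero_of_lt_one hq0
    (inv_lt_one_of_one_lt₀ hL)).eventually (ge_mem_nhds (div_pos hγs hγ))).exists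
  have hle : ∀ n : ℕ, n₀ ≤ n → γ * ((F.L : ℝ)⁻¹) ^ n ≤ min γ₁ γ₂ := fun n hn =>
    calc γ * ((F.L : ℝ)⁻¹) ^ n ≤ γ * ((F.L : ℝ)⁻¹) ^ n₀ :=
          mul_le_mul_of_nonneg_left (pow_le_pow_of_le_one hq0 hq1 hn) hγ.le
      _ ≤ γ * (min γ₁ γ₂ / γ) := mul_le_mul_of_nonneg_left hn₀ hγ.le
      _ = min γ₁ γ₂ := mul_div_cancel₀ _ hγ.ne'
  have hpos : ∀ n : ℕ, 0 < γ * ((F.L : ℝ)⁻¹) ^ n := fun n => mul_pos hγ (pow_pos (inv_pos.mpr hL0) n)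
  have hlim : HasContinuumLimit (F.scheme ℰp γ) :=
    smallFieldWidening_wideningOfTiltAndMass_proof F γ b₀ p₀ n₀ hγ
      (fun n hn => hT'' (F.refine n) _ rfl (hpos n) ((hle n hn).trans (min_le_right _ _)))
      ⟨δ, hδ, fun n K hn => hmass n K ((hle n hn).trans (min_le_left _ _))⟩
  exact (continuumYM3Torus_iff_hasContinuumLimit_SU F ℰp measurableE_ℰp hγ.le).mpr hlim

end Summit.QuantumFields.YangMills.Theorems.LargeFieldMassRefinementTailProfileMono

end
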